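import Literature.Topology.FourManifolds.SmoothPoincareHighDim
import Literature.Topology.FourManifolds.SmoothPoincareLowDimProofs
import Literature.Topology.FourManifolds.SmoothPoincareTwoHolds
import Literature.Topology.FourManifolds.HCobordismThetaFinite
import Literature.Topology.FourManifolds.SmaleHomologySpheresFiveSixKervaireMilnor
import Literature.Topology.FourManifolds.PoincareThreeHomotopyForm
import HarnessLib

/-!
# spc4.S32 after `Θ₁ = Θ₂ = 0`: the exact residue of the smooth Poincaré conjecture in dimensions `1, 2, 3, 5, 6, 12, 56, 61`

Topic `Literature/Topology/FourManifolds` (fact seat of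
`Literature.Topology.FourManifolds.nonemptyDiffeomorphSphere_of_mem`, spc4.S32: every Hausdorff,
second countable smooth `n`-manifold homotopy equivalent to `Sⁿ` is diffeomorphic to `Sⁿ` for
`n ∈ {1, 2, 3, 5, 6, 12, 56, 61}`; Kervaire–Milnor 1963, table p. 504 and §2 p. 507, Wang–Xu 2017,
Cor. 1.15). Everything in this file is **proved**; no definition and no named fact is introduced.

`SmoothPoincareHighDim.lean` proved the residue
`nonemptyDiffeomorphSphere_of_mem_iff_subsingleton`: spc4.S32 (any universe) ⟺ (smooth Poincaré
in dimension `1`) ∧ (`Θₙ` is a point for `n ∈ {2, 3, 5, 6, 12, 56, 61}`). Two of these leaves have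
since become theorems of the tree:

* dimension `1`: `nonemptyDiffeomorphSphere_one_holds` (`SmoothPoincareLowDimProofs.lean`: a
  compact connected smooth `1`-manifold is orientable and diffeomorphic to `S¹`; Milnor,
  *Topology from the differentiable viewpoint*, Appendix);
* dimension `2`, `Θ₂ = 0`: `nonemptyDiffeomorphSphere_two_holds` (`SmoothPoincareTwoHolds.lean`:
  Morse theory on surfaces — Milnor 1965, Thm. 8.1 / proof of Thm. 5.4, no saddles on simply
  connected closed surfaces, the smooth Reeb theorem), whence
  `HomotopySphereClass.subsingleton_two` (`HomotopySpheresGroupDischarge.lean`).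

This file records what that leaves of spc4.S32 (Kervaire–Milnor 1963, p. 504: "It is clear that
`Θ₁ = Θ₂ = 0`. … if one assumes the Poincaré hypothesis, then it can be shown that `Θ₃ = 0`";
table p. 504: `|Θ₅| = |Θ₆| = |Θ₁₂| = 1`; Wang–Xu 2017, Thm. 1.9 (`Θ₆₁`), Thm. 1.14 (Isaksen,
`Θ₅₆`), Cor. 1.15):

* `forall_nonemptyDiffeomorphSphere_of_eq_one_or_eq_two` — the smooth Poincaré conjecture in
  dimensions `1` and `2`, unconditionally, in the shape `n = 1 ∨ n = 2` consumed by
  `HomotopySpheresSumProofs.lean` / `HomotopySpheresGroupLeaves.lean`;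
* `nonemptyDiffeomorphSphere_of_le_three_of_three` — dimensions `1 ≤ n ≤ 3` from Perelman's
  theorem (spc4.S31, `nonempty_diffeomorph_sphere_three`) alone;
* **`nonemptyDiffeomorphSphere_of_mem_iff_forall_subsingleton`** — spc4.S32 (any universe) ⟺
  `Θₙ` is a point for every `n ∈ {3, 5, 6, 12, 56, 61}`: the exact residue now;
* `nonemptyDiffeomorphSphere_of_mem_of_three_of_subsingleton` — spc4.S32 from Perelman's theorem
  and `Θ₅ = Θ₆ = Θ₁₂ = Θ₅₆ = Θ₆₁ = 0` (one point each);
* `nonemptyDiffeomorphSphere_of_mem_of_three_of_isHCobordant` — spc4.S32 from Perelman's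
  theorem, Smale's h-cobordism theorem (spc4.S15, `nonempty_diffeomorph_of_isHCobordant_of_five_le`)
  and `Θₙ = 0` for `n ∈ {5, 6, 12, 56, 61}` in Kervaire–Milnor's own h-cobordism form.
* **`nonemptyDiffeomorphSphere_of_mem_iff_namedLeaves`** (added 2026-08-15, with
  `namedLeaves_of_nonemptyDiffeomorphSphere_of_mem` and
  `nonemptyDiffeomorphSphere_of_mem_of_namedLeaves`) — spc4.S32 over the tree's NAMED FACTS:
  given Milnor's Thm. 9.1 (`isTrivial_of_isHCobordism_of_five_le`, the h-cobordism hub), spc4.S32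
  (any universe) ⟺ spc4.S31 (`nonempty_diffeomorph_sphere_three`, Perelman) ∧
  `Milnor1965_boundsContractible_of_homologySphere` (the Kervaire–Milnor/Wall theorem quoted by
  Milnor 1965, §9 p. 111, for `n = 5, 6` — `Θ₅ = Θ₆ = 0` in h-cobordism form, Kervaire–Milnor
  1963 table p. 504 with Lemma 2.3) ∧ `Θ₁₂`, `Θ₅₆`, `Θ₆₁` are points (no named fact in the tree);
  the direction ⟹ is unconditional.

None of the remaining leaves is in the tree or in Mathlib: Perelman's theorem; Smale's
h-cobordism theorem (the tree's `HCobordismTheoremProofs.lean` programme); `Θ₅ = Θ₆ = Θ₁₂ = 0`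
(Kervaire–Milnor 1963 via surgery, `bPₙ₊₁`, the `J`-homomorphism and Toda's stable stems;
Kosinski 1993, X §6, pp. 217–219); `Θ₅₆ = 0` (Isaksen 2019, motivic Adams spectral sequence
through the 59-stem); `Θ₆₁ = 0` (Wang–Xu 2017, the 61-stem).

## References

* M. Kervaire, J. Milnor, *Groups of homotopy spheres I*, Ann. of Math. (2) 77 (1963), 504–537,
  Thm. 1.2, table p. 504, §2 p. 507. [KervaireMilnorAnnals1963]
* G. Wang, Z. Xu, *The triviality of the 61-stem in the stable homotopy groups of spheres*,
  Ann. of Math. 186 (2017), 501–580, Thm. 1.9, Thm. 1.14, Cor. 1.15 (arXiv:1601.02184 numbering).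
  [WangXu2017]
* D. Isaksen, *Stable stems*, Mem. Amer. Math. Soc. 262 (2019), no. 1269. [Isaksen2019]
* J. Morgan, G. Tian, *Ricci flow and the Poincaré conjecture* (2007), Cor. 0.2 (a). [MorganTian2007]
* A. Kosinski, *Differential Manifolds* (1993), X §6, pp. 217–219. [Kosinski1993]
* J. Milnor, *Lectures on the h-cobordism theorem*, Princeton (1965), §9, Thm. 9.1 (p. 107) and the
  Theorem of Kervaire–Milnor and Wall in the proof of Prop. B (p. 111). [MilnorHCobordism1965]
-/

noncomputable section

open scoped Manifold ContDiff Topology ContinuousMap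

universe u

namespace Literature.Topology.FourManifolds

/-! ### Dimensions `1` and `2` unconditionally, `1 ≤ n ≤ 3` from Perelman -/

/-- **The smooth Poincaré conjecture in dimensions `1` and `2`, unconditionally** (`Θ₁ = Θ₂ = 0`,
Kervaire–Milnor 1963, p. 504 and §2 p. 507), in the shape `n = 1 ∨ n = 2` consumed by
`HomotopySphere.contractibleSpace_compl_image_ball_of` and
`exists_commGroup_homotopySphereClass_of_fiveLeaves`: `nonemptyDiffeomorphSphere_of_eq_one_or_eq_two`
fed with the tree's theorems `nonemptyDiffeomorphSphere_one_holds` (Milnor TDV, Appendix) and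
`nonemptyDiffeomorphSphere_two_holds` (Morse theory on surfaces).
[cite: KervaireMilnorAnnals1963, §2 p. 507] [cite: MilnorTDV1965, Appendix (Classifying 1-manifolds), Theorem p. 55] -/
theorem forall_nonemptyDiffeomorphSphere_of_eq_one_or_eq_two :
    ∀ n : ℕ, n = 1 ∨ n = 2 → ∀ (M : Type u) [TopologicalSpace M] [T2Space M]
      [SecondCountableTopology M], ContinuousMap.HomotopyEquiv.NonemptyDiffeomorphSphere M n :=
  nonemptyDiffeomorphSphere_of_eq_one_or_eq_two nonemptyDiffeomorphSphere_one_holds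
    nonemptyDiffeomorphSphere_two_holds

/-- **The smooth Poincaré conjecture in dimensions `1 ≤ n ≤ 3` from Perelman's theorem alone**
(spc4.S31, `nonempty_diffeomorph_sphere_three`; Morgan–Tian 2007, Cor. 0.2 (a)), dimensions `1`
and `2` being theorems of the tree: `nonemptyDiffeomorphSphere_of_le_three` so fed.
[cite: MorganTian2007, Cor. 0.2 (a)] [cite: KervaireMilnorAnnals1963, §2 p. 507] -/
theorem nonemptyDiffeomorphSphere_of_le_three_of_three (h3 : nonempty_diffeomorph_sphere_three.{u}) :
    ∀ n : ℕ, 1 ≤ n → n ≤ 3 → ∀ (M : Type u) [TopologicalSpace M] [T2Space M]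
      [SecondCountableTopology M], ContinuousMap.HomotopyEquiv.NonemptyDiffeomorphSphere M n :=
  nonemptyDiffeomorphSphere_of_le_three nonemptyDiffeomorphSphere_one_holds
    nonemptyDiffeomorphSphere_two_holds h3

/-! ### spc4.S32 ⟺ `Θₙ` is a point for `n ∈ {3, 5, 6, 12, 56, 61}` -/

/-- **spc4.S32 (every universe) from the triviality of `Θₙ` for `n ∈ {3, 5, 6, 12, 56, 61}`**:
`nonemptyDiffeomorphSphere_of_mem_of_subsingleton` with its dimension-`1` hypothesis discharged by
`nonemptyDiffeomorphSphere_one_holds` and its `n = 2` instance by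
`HomotopySphereClass.subsingleton_two` (`Θ₂ = 0`). Sources for the remaining hypotheses:
Kervaire–Milnor 1963, p. 504 (`Θ₃ = 0` given the Poincaré hypothesis, now Perelman) and table
p. 504 (`Θ₅ = Θ₆ = Θ₁₂ = 0`; proofs printed in Kosinski 1993, X §6, pp. 217–219); Isaksen 2019
(`Θ₅₆ = 0`, Wang–Xu Thm. 1.14); Wang–Xu 2017, Thm. 1.9 (`Θ₆₁ = 0`).
[cite: KervaireMilnorAnnals1963, table p. 504 and §2 p. 507] [cite: Kosinski1993, X §6 pp. 217–219] [cite: WangXu2017, Thm. 1.9, Thm. 1.14, Cor. 1.15 (arXiv numbering)] -/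
theorem nonemptyDiffeomorphSphere_of_mem_of_forall_subsingleton
    (hΘ : ∀ n ∈ ({3, 5, 6, 12, 56, 61} : Set ℕ), Subsingleton (HomotopySphereClass n)) :
    nonemptyDiffeomorphSphere_of_mem.{u} := by
  refine nonemptyDiffeomorphSphere_of_mem_of_subsingleton nonemptyDiffeomorphSphere_one_holds
    fun n hn => ?_
  simp only [Set.mem_insert_iff, Set.mem_singleton_iff] at hn
  rcases hn with rfl | hn
  · exact HomotopySphereClass.subsingleton_two
  · exact hΘ n (by simp only [Set.mem_insert_iff, Set.mem_singleton_iff]; tauto)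

/-- **spc4.S32 ⟺ `Θₙ` is a point for every `n ∈ {3, 5, 6, 12, 56, 61}`**, at every universe and
unconditionally: the exact residue of the named fact `nonemptyDiffeomorphSphere_of_mem` once
`Θ₁ = Θ₂ = 0` are theorems of the tree (`nonemptyDiffeomorphSphere_of_mem_iff_subsingleton` with
its dimension-`1` and dimension-`2` conjuncts discharged). Kervaire–Milnor 1963, Thm. 1.2 and
table p. 504; Wang–Xu 2017, Cor. 1.15: "for `5 ≤ n ≤ 61` … the only ones with unique smooth
structure are `S⁵`, `S⁶`, `S¹²`, `S⁵⁶` and `S⁶¹`".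
[cite: KervaireMilnorAnnals1963, table p. 504 and §2 p. 507] [cite: WangXu2017, Cor. 1.15 (arXiv numbering)] -/
theorem nonemptyDiffeomorphSphere_of_mem_iff_forall_subsingleton :
    nonemptyDiffeomorphSphere_of_mem.{u} ↔
      ∀ n ∈ ({3, 5, 6, 12, 56, 61} : Set ℕ), Subsingleton (HomotopySphereClass n) := by
  refine ⟨fun h n hn => ?_, nonemptyDiffeomorphSphere_of_mem_of_forall_subsingleton⟩
  refine (nonemptyDiffeomorphSphere_of_mem_iff_subsingleton.mp h).2 n ?_
  simp only [Set.mem_insert_iff, Set.mem_singleton_iff] at hn ⊢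
  tauto

/-! ### spc4.S32 from Perelman's theorem and `Θ₅ = Θ₆ = Θ₁₂ = Θ₅₆ = Θ₆₁ = 0` -/

/-- **spc4.S32 (every universe) from Perelman's theorem and `Θₙ = 0` for `n ∈ {5, 6, 12, 56, 61}`.**
The dimension-`3` conjunct of `nonemptyDiffeomorphSphere_of_mem_iff_forall_subsingleton` is
supplied by spc4.S31 (`nonempty_diffeomorph_sphere_three`, Perelman; Morgan–Tian 2007,
Cor. 0.2 (a)) through `HomotopySphereClass.subsingleton_three_of` (Kervaire–Milnor 1963, p. 504:
"if one assumes the Poincaré hypothesis, then it can be shown that `Θ₃ = 0`"); the others are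
Kervaire–Milnor's table p. 504 (`n = 5, 6, 12`), Isaksen 2019 (`n = 56`) and Wang–Xu 2017,
Thm. 1.9 (`n = 61`).
[cite: MorganTian2007, Cor. 0.2 (a)] [cite: KervaireMilnorAnnals1963, table p. 504 and remark after Thm. 1.2] [cite: WangXu2017, Thm. 1.9, Thm. 1.14 (arXiv numbering)] -/
theorem nonemptyDiffeomorphSphere_of_mem_of_three_of_subsingleton
    (h3 : nonempty_diffeomorph_sphere_three.{0})
    (hΘ : ∀ n ∈ ({5, 6, 12, 56, 61} : Set ℕ), Subsingleton (HomotopySphereClass n)) :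
    nonemptyDiffeomorphSphere_of_mem.{u} := by
  refine nonemptyDiffeomorphSphere_of_mem_of_forall_subsingleton fun n hn => ?_
  simp only [Set.mem_insert_iff, Set.mem_singleton_iff] at hn
  rcases hn with rfl | hn
  · exact HomotopySphereClass.subsingleton_three_of h3
  · exact hΘ n (by simp only [Set.mem_insert_iff, Set.mem_singleton_iff]; tauto)

/-- **spc4.S32 (every universe) from Perelman's theorem, Smale's h-cobordism theorem and
`Θₙ = 0` (`n ∈ {5, 6, 12, 56, 61}`) in Kervaire–Milnor's h-cobordism form**: every closed smooth
`n`-manifold `M ≃ₕ 𝕊ⁿ` (`M : Type`) is h-cobordant to `𝕊ⁿ` (the group `Θₙ` of the source is the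
group of h-cobordism classes, §1), together with spc4.S15
(`nonempty_diffeomorph_of_isHCobordant_of_five_le`; Smale 1962, Milnor 1965 Thm. 9.1) —
`nonemptyDiffeomorphSphere_of_mem_of_leaves` with its dimension-`1` and dimension-`2` leaves
discharged by `nonemptyDiffeomorphSphere_one_holds` and `nonemptyDiffeomorphSphere_two_holds`.
[cite: KervaireMilnorAnnals1963, §1 and table p. 504] [cite: MilnorHCobordism1965, Thm. 9.1] [cite: MorganTian2007, Cor. 0.2 (a)] [cite: WangXu2017, Thm. 1.9, Thm. 1.14 (arXiv numbering)] -/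
theorem nonemptyDiffeomorphSphere_of_mem_of_three_of_isHCobordant
    (h3 : nonempty_diffeomorph_sphere_three.{0})
    (hS15 : nonempty_diffeomorph_of_isHCobordant_of_five_le.{0})
    (hΘ : ∀ n ∈ ({5, 6, 12, 56, 61} : Set ℕ), ∀ (M : Type) [TopologicalSpace M] [T2Space M]
      [SecondCountableTopology M] [ChartedSpace (EuclideanSpace ℝ (Fin n)) M]
      [IsManifold (𝓡 n) ∞ M] [CompactSpace M],
      M ≃ₕ (Metric.sphere (0 : EuclideanSpace ℝ (Fin (n + 1))) 1) →
        IsHCobordant n M (Metric.sphere (0 : EuclideanSpace ℝ (Fin (n + 1))) 1)) :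
    nonemptyDiffeomorphSphere_of_mem.{u} :=
  nonemptyDiffeomorphSphere_of_mem_of_leaves nonemptyDiffeomorphSphere_one_holds
    nonemptyDiffeomorphSphere_two_holds h3 hS15 hΘ

/-! ### spc4.S32 over the tree's named facts

What a discharge `nonemptyDiffeomorphSphere_of_mem_holds` needs from the tree, exactly, in terms
of the named facts that exist (2026-08-15): Perelman's theorem (spc4.S31), Milnor's Thm. 9.1 (the
h-cobordism hub of spc4.S15) and the Kervaire–Milnor/Wall theorem for `n = 5, 6` quoted by Milnor
(`Milnor1965_boundsContractible_of_homologySphere`, which `SmaleHomologySpheresFiveSixKervaireMilnor.lean`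
proves equivalent to `Θ₅ = Θ₆ = 0` in Kervaire–Milnor's h-cobordism form), plus the three
computations `Θ₁₂ = Θ₅₆ = Θ₆₁ = 0` for which the tree has no named fact (Kervaire–Milnor 1963,
table p. 504: `Θ₁₂ = 0` via `bP₁₃ = 0` and `π₁₂ˢ = 0`; Isaksen 2019: `S⁵⁶`; Wang–Xu 2017, Thm. 1.9:
`S⁶¹`). -/

/-- **spc4.S32 implies its named leaves, unconditionally**: Perelman's theorem in the form of
spc4.S31 (`nonempty_diffeomorph_sphere_three_of_mem`: the list contains `3`), the Kervaire–Milnor/Wall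
theorem for `n = 5, 6` quoted by Milnor (a closed smooth `M ≃ₕ Sⁿ`, `n ∈ {5, 6}`, is then
diffeomorphic, hence h-cobordant, to `Sⁿ` — `isHCobordant_sphere_of_forall_nonemptyDiffeomorphSphere` —
and `Milnor1965_boundsContractible_of_homologySphere_iff_isHCobordant_sphere`, i.e. Kervaire–Milnor's
Lemma 2.3 with the recognition theorem), and one-point `Θ₁₂`, `Θ₅₆`, `Θ₆₁`
(`nonemptyDiffeomorphSphere_of_mem_iff_forall_subsingleton`, which also moves spc4.S32 between
universes). [cite: KervaireMilnorAnnals1963, §1, table p. 504, Lemma 2.3 (p. 506)] [cite: MilnorHCobordism1965, §9, Theorem of Kervaire–Milnor and Wall (p. 111)] [cite: MorganTian2007, Cor. 0.2 (a)] [cite: WangXu2017, Thm. 1.9, Thm. 1.14 (arXiv numbering)] -/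
theorem namedLeaves_of_nonemptyDiffeomorphSphere_of_mem (h : nonemptyDiffeomorphSphere_of_mem.{u}) :
    nonempty_diffeomorph_sphere_three.{0} ∧ Milnor1965_boundsContractible_of_homologySphere.{0} ∧
      Subsingleton (HomotopySphereClass 12) ∧ Subsingleton (HomotopySphereClass 56) ∧
        Subsingleton (HomotopySphereClass 61) := by
  have hΘ := nonemptyDiffeomorphSphere_of_mem_iff_forall_subsingleton.{u}.mp h
  have h0 : nonemptyDiffeomorphSphere_of_mem.{0} :=
    nonemptyDiffeomorphSphere_of_mem_iff_forall_subsingleton.{0}.mpr hΘ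
  refine ⟨nonempty_diffeomorph_sphere_three_of_mem h0, ?_, hΘ 12 (by simp), hΘ 56 (by simp),
    hΘ 61 (by simp)⟩
  refine Milnor1965_boundsContractible_of_homologySphere_iff_isHCobordant_sphere.mpr ?_
  intro n hn M _ _ _ _ _ _ e
  have hmem : n ∈ ({1, 2, 3, 5, 6, 12, 56, 61} : Set ℕ) := by
    rcases hn with rfl | rfl <;> simp
  exact isHCobordant_sphere_of_forall_nonemptyDiffeomorphSphere (h0 n hmem) M e

/-- **spc4.S32 (every universe) from its named leaves**: Perelman's theorem (spc4.S31,
`nonempty_diffeomorph_sphere_three`; Morgan–Tian 2007, Cor. 0.2 (a)), Milnor's Thm. 9.1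
(`isTrivial_of_isHCobordism_of_five_le`; *Lectures on the h-cobordism theorem*, p. 107), the
Kervaire–Milnor/Wall theorem for `n = 5, 6` quoted there on p. 111
(`Milnor1965_boundsContractible_of_homologySphere`; Kervaire–Milnor 1963, table p. 504,
`|Θ₅| = |Θ₆| = 1`), and one-point `Θ₁₂` (Kervaire–Milnor 1963, table p. 504), `Θ₅₆` (Isaksen 2019;
Wang–Xu 2017, Thm. 1.14), `Θ₆₁` (Wang–Xu 2017, Thm. 1.9).  Thm. 9.1 with the `n = 5, 6` theorem gives
the diffeomorphism clause of Milnor's Prop. B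
(`nonempty_diffeomorph_sphere_of_homologySphere_five_six_of_two_hubs'`), hence `Θ₅ = Θ₆ = 0`
(`subsingleton_homotopySphereClass_of_nonempty_diffeomorph_sphere_of_homologySphere_five_six`), and
`nonemptyDiffeomorphSphere_of_mem_of_three_of_subsingleton` concludes.
[cite: KervaireMilnorAnnals1963, Thm. 1.2 and table p. 504] [cite: MilnorHCobordism1965, §9, Thm. 9.1 (p. 107), Prop. B (p. 109) and p. 111] [cite: MorganTian2007, Cor. 0.2 (a)] [cite: WangXu2017, Thm. 1.9, Thm. 1.14, Cor. 1.15 (arXiv numbering)] -/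
theorem nonemptyDiffeomorphSphere_of_mem_of_namedLeaves
    (h3 : nonempty_diffeomorph_sphere_three.{0})
    (h91 : isTrivial_of_isHCobordism_of_five_le.{0})
    (hKM : Milnor1965_boundsContractible_of_homologySphere.{0})
    (h12 : Subsingleton (HomotopySphereClass 12)) (h56 : Subsingleton (HomotopySphereClass 56))
    (h61 : Subsingleton (HomotopySphereClass 61)) :
    nonemptyDiffeomorphSphere_of_mem.{u} := by
  obtain ⟨h5, h6⟩ :=
    subsingleton_homotopySphereClass_of_nonempty_diffeomorph_sphere_of_homologySphere_five_six
      (nonempty_diffeomorph_sphere_of_homologySphere_five_six_of_two_hubs'.{0} h91 hKM)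
  refine nonemptyDiffeomorphSphere_of_mem_of_three_of_subsingleton h3 fun n hn => ?_
  simp only [Set.mem_insert_iff, Set.mem_singleton_iff] at hn
  rcases hn with rfl | rfl | rfl | rfl | rfl <;> assumption

/-- **The exact residue of spc4.S32 over the tree's named facts.**  GIVEN Milnor's Thm. 9.1
(`isTrivial_of_isHCobordism_of_five_le`, needed only for ⟸: it turns `Θ₅ = Θ₆ = 0` in
h-cobordism form into diffeomorphisms), spc4.S32 at any universe is EQUIVALENT to: spc4.S31
(Perelman) ∧ the Kervaire–Milnor/Wall theorem for `n = 5, 6` quoted by Milnor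
(`Milnor1965_boundsContractible_of_homologySphere`, `Θ₅ = Θ₆ = 0`) ∧ `Θ₁₂`, `Θ₅₆`, `Θ₆₁` are points.
Kervaire–Milnor 1963, Thm. 1.2 and table p. 504; Wang–Xu 2017, Cor. 1.15.
[cite: KervaireMilnorAnnals1963, Thm. 1.2 and table p. 504] [cite: MilnorHCobordism1965, §9, Thm. 9.1 (p. 107) and p. 111] [cite: MorganTian2007, Cor. 0.2 (a)] [cite: WangXu2017, Thm. 1.9, Thm. 1.14, Cor. 1.15 (arXiv numbering)] -/
theorem nonemptyDiffeomorphSphere_of_mem_iff_namedLeaves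
    (h91 : isTrivial_of_isHCobordism_of_five_le.{0}) :
    nonemptyDiffeomorphSphere_of_mem.{u} ↔
      nonempty_diffeomorph_sphere_three.{0} ∧ Milnor1965_boundsContractible_of_homologySphere.{0} ∧
        Subsingleton (HomotopySphereClass 12) ∧ Subsingleton (HomotopySphereClass 56) ∧
          Subsingleton (HomotopySphereClass 61) :=
  ⟨namedLeaves_of_nonemptyDiffeomorphSphere_of_mem, fun h =>
    nonemptyDiffeomorphSphere_of_mem_of_namedLeaves h.1 h91 h.2.1 h.2.2.1 h.2.2.2.1 h.2.2.2.2⟩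

end Literature.Topology.FourManifolds

end
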